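import Mathlib

/-!
Sketch (ideator ym-r3-idea-1 g19, crux idea «neumann-frd-step»): the FIRST LEMMA of the line — the Neumann finite-range
decomposition of a uniformly gapped finite-range symmetric matrix, with LOCALITY IN THE ENTRIES degree by degree.
Elaboration only; nothing proved here.
-/

namespace Summit.QuantumFields.YangMills.Cruxes.FluctuationComparisonRegPrIntL.NeumannFRD

open Matrix

/-- **NEUMANN FINITE-RANGE DECOMPOSITION WITH ENTRYWISE LOCALITY.**  For a real symmetric matrix `M` on a finite index set with a
pseudo-metric `dist`, of range `r` (`M a c = 0` when `dist a c > r`) and spectrum in `[m, B]` (`0 < m ≤ B`):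
the pieces `Γ_t := B⁻¹ (1 − M/B)^t` (universal polynomials in `M`) have range `≤ r t`, are positive semi-definite with
`Γ_t ≤ B⁻¹ (1 − m/B)^t`, sum to `M⁻¹`, and — the clause that makes the background dependence LOCAL for free — the entry
`((1 − M/B)^t) a c` depends only on the entries `M x y` with `dist a x ≤ r t`, `dist a y ≤ r t`. -/
def NeumannFRD : Prop :=
  ∀ (ι : Type) [Fintype ι] [DecidableEq ι] (dist : ι → ι → ℕ) (r : ℕ) (m B : ℝ) (M : Matrix ι ι ℝ),
    0 < m → m ≤ B → M.IsSymm →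
    (∀ a, dist a a = 0) → (∀ a c, dist a c = dist c a) → (∀ a b c, dist a c ≤ dist a b + dist b c) →
    (∀ a c, r < dist a c → M a c = 0) →
    (∀ x : ι → ℝ, m * (∑ a, x a ^ 2) ≤ ∑ a, ∑ c, x a * M a c * x c) →
    (∀ x : ι → ℝ, ∑ a, ∑ c, x a * M a c * x c ≤ B * (∑ a, x a ^ 2)) →
      (∀ (t : ℕ) (a c : ι), r * t < dist a c → ((1 - B⁻¹ • M) ^ t) a c = 0) ∧
      (∀ (t : ℕ) (x : ι → ℝ), 0 ≤ ∑ a, ∑ c, x a * ((1 - B⁻¹ • M) ^ t) a c * x c) ∧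
      (∀ (t : ℕ) (x : ι → ℝ), ∑ a, ∑ c, x a * ((1 - B⁻¹ • M) ^ t) a c * x c ≤ (1 - m / B) ^ t * ∑ a, x a ^ 2) ∧
      HasSum (fun t : ℕ => B⁻¹ • (1 - B⁻¹ • M) ^ t) M⁻¹ ∧
      (∀ (t : ℕ) (a c : ι) (M' : Matrix ι ι ℝ), (∀ x y, dist a x ≤ r * t → dist a y ≤ r * t → M x y = M' x y) →
        (∀ x y, r < dist x y → M' x y = 0) → ((1 - B⁻¹ • M) ^ t) a c = ((1 - B⁻¹ • M') ^ t) a c)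

/-- The FAMILY form the step uses: a `U`-indexed family of such matrices whose entries near `a` depend on `U` near `a` yields pieces
`Γ_t(U)` whose entries near `a` depend on `U` within `r t` of `a` — stated for an abstract parameter space with «agreement» sets. -/
def NeumannFRDFamilyLocal : Prop :=
  ∀ (ι P : Type) [Fintype ι] [DecidableEq ι] (dist : ι → ι → ℕ) (r : ℕ) (B : ℝ)
    (agree : ι → ℕ → P → P → Prop)            -- «U and U' agree within distance n of a»
    (M : P → Matrix ι ι ℝ),
    (∀ a n U U', agree a n U U' → ∀ x y, dist a x ≤ n → dist a y ≤ n → M U x y = M U' x y) →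
    (∀ U x y, r < dist x y → M U x y = 0) →
    (∀ a, dist a a = 0) → (∀ a c, dist a c = dist c a) → (∀ a b c, dist a c ≤ dist a b + dist b c) →
    ∀ (t : ℕ) (a c : ι) (U U' : P), agree a (r * t) U U' → ((1 - B⁻¹ • M U) ^ t) a c = ((1 - B⁻¹ • M U') ^ t) a c

end Summit.QuantumFields.YangMills.Cruxes.FluctuationComparisonRegPrIntL.NeumannFRD
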